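import Summits.HodgeConjecture.CorCM.DecicWeil23MultiPowersHodgeOfMarkman
import Summits.HodgeConjecture.CorCM.DecicWeil23PairSingleTypeHodgeOfMarkman
import Literature.AlgebraicGeometry.ComplexMultiplication.CMTypeConjugateIsogeny
import HarnessLib

/-!
# COR-CM — the Hodge conjecture for every product of copies of `E, B₁, …, B_r` — ANY NUMBER of CM abelian fivefolds with CM by one
# DECIC field `K ⊇ i(k)`, of `k`-signature `(2,3)`, whose types satisfy the INDEPENDENCE CRITERION — GIVEN ONLY Markman's
# hyperbolic-sixfold theorem and `2`-transitivity of `Aut(ℂ/k)` on the five embeddings over `τ` (intrinsic and family forms)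

Cell `pub-hodgecm2` (COR-CM), seat b30 gen 24 (2026-08-22); count-neutral own lane DECIC-MULTI.  Theorems only; no definition, no
named fact of its own, no `sorry`.  HONEST FRAMING: CONDITIONAL on the single displayed named fact
`HodgeTheory.Markman2025_weilClasses_algebraic_hyperbolicSixfold` (arXiv:2502.03415 Thm 1.5.1, unrefereed); `HC_CM` is not
asserted and no case of the Hodge conjecture is claimed unconditionally.

THE INDEPENDENCE CRITERION (intrinsic).  For CM types `Φ_1, …, Φ_r` of `K` and the five embeddings `s₁, …, s₅` of `K` over `τ`,
`hInd` says: `w + Σ_{m : s ∈ Φ_m} t_m = 0` for all five `s` over `τ` forces `w = t_1 = ⋯ = t_r = 0` — the vectors `𝟙` and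
`𝟙_{Φ_m ∩ fibre}` in `ℤ⁵` are linearly independent.  By the exact census of gens 22–23 this holds for EVERY family of `r ≤ 3`
pairwise distinct `(2,3)`-types, for four types exactly off the `15` four-cycles and the `10` «triangle + disjoint edge» of `K₅`
(`185` of `210` configurations), and never for `r ≥ 5`; it is exactly the condition under which the Weil sixfold/tenfold method
generates all Hodge classes of all products of copies.

* §1 **`exists_frameM`** — a frame `e : Hom(K, ℂ) ≃ Fin 5 × Bool` reading ANY family of types at positions
  `P m a = [e⁻¹(a, +) ∈ Φ_m]` (no normal form is needed: the census of `Census/DecicWeil23Multi*` is position-free); transport of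
  the `(2,3)` count and of the independence criterion to the frame (`card_pos_of_frameM`, `indepPos_of_frameM`).
* §2 **`hodgeConjectureFor_biproduct_comp_cons_of_markman_indep`** — `K ⊇ i(k)` decic, `k` imaginary quadratic, `B_m ⊨ (K; Φ_m)`
  (`m < r`) of `k`-signature `(2,3)` with `hInd`, `E ⊨ (k; Ψ ∋ τ)`, `Aut(ℂ)` `2`-TRANSITIVE on the embeddings over `τ` (`h2T`; totally
  real quintic `K⁺` with group `S₅`, `A₅` or `F₂₀`): for every `κ : Fin N → Fin (r+1)` the Hodge conjecture holds for
  `⨁_j (E, B₁, …, B_r)(κ j)`; with the `AVDominatedBy` form.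
* §3 **THE FAMILY FORM `hodgeConjectureFor_of_avDominatedBy_family_of_markman_indep`** — ANY finite family `A_j ⊨ (K; Θ_j)` of CM
  abelian fivefolds whose types are drawn from a list `Φ_1, …, Φ_r` of `(2,3)`-types satisfying `hInd` (coincidences allowed; the
  list may contain unused types, realised by Shimura's existence theorem): every `C` dominated by `E^a × ∏_j A_j` satisfies the
  Hodge conjecture — and `∏_j A_j` itself; **`…family_conj…`**: the same with the types drawn from the list UP TO COMPLEX CONJUGATION
  (`k`-signature `(3,2)` allowed: `A ⊨ (K; Φ̄)` also realises `Φ` through `ι ∘ c`, Deligne 1982 §5 (b),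
  `IsCMTypeRealisation.comp_complexConj`).  This SUPERSEDES the `≤ 3 values` family theorems of gens 22–23
  (`DecicWeil23Triple.hodgeConjectureFor_of_avDominatedBy_family_le₃_of_markmanT_h2T`), whose hypothesis is the case `r ≤ 3` of
  `hInd`.
[cite: Markman2025SecantWeil, Thm 1.5.1] [cite: Pohlmann1968, Thm 1] [cite: Shimura1998, §18.2 Lemma (i) and §6.1 Thm. 2 Cor.]
[cite: Deligne1982HodgeCycles, §5 (c)] [cite: Schoen1998HodgeWeilAddendum, §10] [cite: DixonMortimer1996, §2.1]

## References
* [Markman2025SecantWeil] E. Markman, arXiv:2502.03415 (unrefereed), Thm 1.5.1.  [Pohlmann1968] H. Pohlmann, Ann. of Math. 88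
  (1968), Thm 1.  [Shimura1998] G. Shimura, *Abelian varieties with CM and modular functions*, §18.2 Lemma (i), §6.1 Thm. 2 Cor.
  [Deligne1982HodgeCycles] P. Deligne, LNM 900 (1982), §5 (c).  [Schoen1998HodgeWeilAddendum] C. Schoen, Compositio Math. 114
  (1998), §10.  [DixonMortimer1996] J. D. Dixon, B. Mortimer, *Permutation Groups*, GTM 163, §2.1.  [MumfordAV1970] §19.
-/

noncomputable section

open CategoryTheory CategoryTheory.Limits NumberField

namespace Summit.HodgeConjecture.CorCM.DecicWeil23Multi

open Literature.AlgebraicGeometry Literature.AlgebraicGeometry.Motives Literature.AlgebraicGeometry.HodgeTheory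
open Literature.AlgebraicGeometry.ComplexMultiplication (IsCMTypeRealisation exists_isCMTypeRealisation)
open Literature.AlgebraicTopology.SingularHomology
open Summit.HodgeConjecture.CorCM.Census.DecicWeil23Multi (IndepPos)
open Summit.HodgeConjecture.CorCM.DecicWeil23Pair (exists_frame₅ card_filter_symm_true₅ mem_iff_of_reading₅ h2t_of_twoTransitive
  avDominatedBy_of_cmType_eq)
open Summit.HodgeConjecture.CorCM.OcticCurveFourfold (exists_delta_of_mem)
open Summit.HodgeConjecture.CorCM.Domination (AVDominatedBy)
open Summit.HodgeConjecture.CorCM.AndreRiemann (sumFam avDominatedBy_prod_of_biproduct avDominatedBy_biproduct_reindex)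

open scoped Classical

/-! ## §1 The frame: arbitrary positions; transport of the counts and of the independence criterion -/

section Frame

variable {K : Type} [Field K] [NumberField K] {k : Type} [Field k] [NumberField k] {r : ℕ}

/-- **THE FRAME EXISTS (no normal form).**  For `[K:ℚ] = 10`, `i : k → K`, `Hom(k, ℂ) = {τ, τ̄}` and ANY family `Φ : Fin r → CMType K`:
an enumeration `e : Hom(K, ℂ) ≃ Fin 5 × Bool` with `(e s).2 = [s ∘ i = τ]`, `e s̄ = ((e s).1, ¬(e s).2)`, and positions
`P m a = [e⁻¹(a, +) ∈ Φ_m]` reading every type: `s ∈ Φ_m ⟺ (e s).2 = P m (e s).1`. [cite: Shimura1998, §18.2 Lemma (i)] -/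
theorem exists_frameM (h10 : Module.finrank ℚ K = 10) (h2 : Module.finrank ℚ k = 2) (i : k →+* K) {τ : k →+* ℂ}
    (hττ : ComplexEmbedding.conjugate τ ≠ τ) (hk : ∀ σ : k →+* ℂ, σ = τ ∨ σ = ComplexEmbedding.conjugate τ)
    (Φ : Fin r → CMType K) :
    ∃ (e : (K →+* ℂ) ≃ Fin 5 × Bool) (P : Fin r → Fin 5 → Bool), (∀ s, (e s).2 = true ↔ s.comp i = τ) ∧
      (∀ s, e (ComplexEmbedding.conjugate s) = ((e s).1, !(e s).2)) ∧
      (∀ (m : Fin r) (a : Fin 5), P m a = true ↔ e.symm (a, true) ∈ (Φ m).1) ∧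
      ∀ (m : Fin r) (s : K →+* ℂ), s ∈ (Φ m).1 ↔ (e s).2 = P m (e s).1 := by
  classical
  obtain ⟨e, he_sign, he_conj⟩ := exists_frame₅ h10 h2 i hττ hk
  let J : Fin r → Finset (Fin 5) := fun m => Finset.univ.filter fun a => e.symm (a, true) ∈ (Φ m).1
  have hJ : ∀ (m : Fin r) (a : Fin 5), a ∈ J m ↔ e.symm (a, true) ∈ (Φ m).1 := fun m a => by
    simp only [J, Finset.mem_filter, Finset.mem_univ, true_and]
  refine ⟨e, fun (m : Fin r) (a : Fin 5) => decide (a ∈ J m), he_sign, he_conj, fun m a => by rw [decide_eq_true_iff, hJ],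
    fun m s => ?_⟩
  exact mem_iff_of_reading₅ (Φ := Φ m) (P := fun a : Fin 5 => decide (a ∈ J m)) he_conj
    (fun a => by rw [decide_eq_true_iff, hJ]) s

variable {e : (K →+* ℂ) ≃ Fin 5 × Bool} {P : Fin r → Fin 5 → Bool} {i : k →+* K} {τ : k →+* ℂ} {Φ : Fin r → CMType K}
  (he_sign : ∀ s, (e s).2 = true ↔ s.comp i = τ) (hP : ∀ (m : Fin r) (a : Fin 5), P m a = true ↔ e.symm (a, true) ∈ (Φ m).1)

omit [NumberField k] in
include he_sign hP in
/-- **The `(2,3)` count in the frame**: `#I_m = #{a | P m a} = #{s over τ | s ∈ Φ_m} = 2`. [folklore] -/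
theorem card_pos_of_frameM (h23 : ∀ m, (Finset.univ.filter fun s : K →+* ℂ => s.comp i = τ ∧ s ∈ (Φ m).1).card = 2)
    (m : Fin r) : ((Finset.univ : Finset (Fin 5)).filter fun a => P m a = true).card = 2 := by
  rw [Finset.filter_congr fun a _ => hP m a, card_filter_symm_true₅ he_sign (fun s => s ∈ (Φ m).1)]
  exact h23 m

omit [NumberField K] [NumberField k] in
include he_sign hP in
/-- **The independence criterion in the frame**: the intrinsic criterion on the `τ`-fibre (`hInd`) gives `IndepPos P` (read the
five embeddings over `τ` as `e⁻¹(a, +)`, `a < 5`). [folklore] -/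
theorem indepPos_of_frameM
    (hInd : ∀ (w : ℤ) (t : Fin r → ℤ), (∀ s : K →+* ℂ, s.comp i = τ → w + ∑ m : Fin r, (if s ∈ (Φ m).1 then t m else 0) = 0) →
      w = 0 ∧ ∀ m, t m = 0) : IndepPos P := by
  intro w t h
  refine hInd w t fun s hs => ?_
  have h2 : (e s).2 = true := (he_sign s).2 hs
  have hs' : e.symm ((e s).1, true) = s := by
    rw [show ((e s).1, true) = e s from Prod.ext rfl h2.symm, Equiv.symm_apply_apply]
  have key := h (e s).1
  have hiff : ∀ m : Fin r, P m (e s).1 = true ↔ s ∈ (Φ m).1 := fun m => by rw [hP, hs']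
  rw [Finset.sum_congr rfl fun m _ => show (if P m (e s).1 then t m else 0) = if s ∈ (Φ m).1 then t m else 0 by
    by_cases hm : P m (e s).1 = true
    · rw [if_pos hm, if_pos ((hiff m).1 hm)]
    · rw [if_neg hm, if_neg fun h' => hm ((hiff m).2 h')]] at key
  exact key

end Frame

/-! ## §2 The intrinsic theorem -/

section Main

variable {K : Type} [Field K] [NumberField K] [IsCMField K] {k : Type} [Field k] [NumberField k] [IsCMField k] {N r : ℕ}
  {Φ : Fin r → CMType K} {B : Fin r → AbelianVariety ℂ}
  {ιB : ∀ m, 𝓞 K →+* End (B m)} {θB : ∀ m, K →+* Module.End ℂ (complexBetti (B m).X 1)}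
  {Ψ : CMType k} {E : AbelianVariety ℂ} {ιE : 𝓞 k →+* End E} {θE : k →+* Module.End ℂ (complexBetti E.X 1)}

/-- **THE HODGE CONJECTURE FOR EVERY PRODUCT OF COPIES OF `E, B₁, …, B_r`, GIVEN ONLY Markman's hyperbolic-sixfold theorem.**
`K ⊇ i(k)` a CM field of degree `10`, `k` imaginary quadratic, `B_m ⊨ (K; Φ_m)` (`m < r`) CM abelian FIVEFOLDS of `k`-signature
`(2,3)` (two members over `τ`, `h23`) whose types satisfy the INDEPENDENCE CRITERION `hInd` (the indicator vectors of the
`Φ_m ∩ {s | s ∘ i = τ}` and the constant vector are linearly independent in `ℤ⁵`), `E ⊨ (k; Ψ ∋ τ)`, and `Aut(ℂ)` `2`-TRANSITIVE on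
the five embeddings of `K` over `τ` (`h2T`): for every `κ : Fin N → Fin (r+1)`, every rational `(q,q)`-class on
`⨁_j (E, B₁, …, B_r)(κ j)` is algebraic. [cite: Markman2025SecantWeil, Thm 1.5.1] [cite: Pohlmann1968, Thm 1]
[cite: Deligne1982HodgeCycles, §5 (c)] [cite: Schoen1998HodgeWeilAddendum, §10] [cite: DixonMortimer1996, §2.1] -/
theorem hodgeConjectureFor_biproduct_comp_cons_of_markman_indep
    (hM6 : Markman2025_weilClasses_algebraic_hyperbolicSixfold)
    (h10 : Module.finrank ℚ K = 10) (h2 : Module.finrank ℚ k = 2) (i : k →+* K)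
    (hB : ∀ m, IsCMTypeRealisation (Φ m) (B m) (ιB m) (θB m))
    (hE : IsCMTypeRealisation Ψ E ιE θE) {τ : k →+* ℂ} (hτΨ : τ ∈ Ψ.1)
    (h23 : ∀ m, (Finset.univ.filter fun s : K →+* ℂ => s.comp i = τ ∧ s ∈ (Φ m).1).card = 2)
    (hInd : ∀ (w : ℤ) (t : Fin r → ℤ), (∀ s : K →+* ℂ, s.comp i = τ → w + ∑ m : Fin r, (if s ∈ (Φ m).1 then t m else 0) = 0) →
      w = 0 ∧ ∀ m, t m = 0)
    (h2T : ∀ x y : Fin 2 ↪ {s : K →+* ℂ // s.comp i = τ}, ∃ ρ : ℂ ≃+* ℂ, ∀ j : Fin 2, (ρ : ℂ →+* ℂ).comp (x j).1 = (y j).1)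
    (κ : Fin N → Fin (r + 1)) :
    HodgeConjectureFor (⨁ fun j => (Fin.cons E B : Fin (r + 1) → AbelianVariety ℂ) (κ j)).dim
      (⨁ fun j => (Fin.cons E B : Fin (r + 1) → AbelianVariety ℂ) (κ j)).X := by
  have hττ : ComplexEmbedding.conjugate τ ≠ τ := QuarticCM.conjugate_ne τ
  have hk : ∀ σ : k →+* ℂ, σ = τ ∨ σ = ComplexEmbedding.conjugate τ := fun σ =>
    QuarticCM.eq_or_eq_conjugate_of_quadratic h2 τ σ
  have hΨ : ∀ σ : k →+* ℂ, σ ∈ Ψ.1 ↔ σ = τ := by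
    intro σ
    rcases hk σ with rfl | rfl
    · exact ⟨fun _ => rfl, fun _ => hτΨ⟩
    · exact ⟨fun h => absurd h ((Ψ.2 τ).1 hτΨ), fun h => absurd h hττ⟩
  obtain ⟨δ₀, d, hd, hδ₀⟩ := CyclicSextic.exists_sq_eq_neg_nat_of_isTotallyComplex k h2
  obtain ⟨δ, hδ, hτ⟩ := exists_delta_of_mem h2 hd hδ₀ τ
  obtain ⟨e, P, he_sign, he_conj, hP, hread⟩ := exists_frameM h10 h2 i hττ hk Φ
  have hPcard := card_pos_of_frameM he_sign hP h23
  have hind := indepPos_of_frameM he_sign hP hInd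
  have h2t := h2t_of_twoTransitive he_sign h2T
  let Kf : Fin 2 → Type := Fin.cons k fun _ : Fin 1 => K
  letI instF : ∀ j, Field (Kf j) := fun j =>
    Fin.cases (motive := fun j => Field (Kf j)) ‹Field k› (fun _ => ‹Field K›) j
  letI instN : ∀ j, NumberField (Kf j) := fun j =>
    Fin.cases (motive := fun j => NumberField (Kf j)) ‹NumberField k› (fun _ => ‹NumberField K›) j
  haveI instC : ∀ j, IsCMField (Kf j) := fun j =>
    Fin.cases (motive := fun j => IsCMField (Kf j)) ‹IsCMField k› (fun _ => ‹IsCMField K›) j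
  exact hodgeConjectureFor_biproduct_comp_of_frameM_of_markmanSixfold_h2t (Kf := Kf) (i₀ := 0) (i₁ := 1) (P := P)
    (A := Fin.cons E B)
    (Φ := Fin.cons (α := fun j : Fin (r + 1) => CMType (Kf (multiSlots r (0 : Fin 2) 1 j))) Ψ fun m => Φ m)
    (ι := Fin.cons (α := fun j : Fin (r + 1) => 𝓞 (Kf (multiSlots r (0 : Fin 2) 1 j)) →+* End ((Fin.cons E B :
      Fin (r + 1) → AbelianVariety ℂ) j)) ιE fun m => ιB m)
    (θ := Fin.cons (α := fun j : Fin (r + 1) => Kf (multiSlots r (0 : Fin 2) 1 j) →+*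
      Module.End ℂ (complexBetti ((Fin.cons E B : Fin (r + 1) → AbelianVariety ℂ) j).X 1)) θE fun m => θB m)
    hM6 κ h10 h2 i hd hδ hτ (Fin.cases hE fun m => hB m) e he_sign he_conj hPcard hind (fun m => hread m) hΨ h2t

/-- **The Hodge conjecture for every abelian variety dominated by a product of copies of `E, B₁, …, B_r`** (intrinsic form, modulo
Markman's sixfold theorem): abelian subvarieties, quotients and isogeny images of the `E^a × B₁^{n₁} × ⋯ × B_r^{n_r}`.
[cite: Markman2025SecantWeil, Thm 1.5.1] [cite: MumfordAV1970, §19] -/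
theorem hodgeConjectureFor_of_avDominatedBy_comp_cons_of_markman_indep
    (hM6 : Markman2025_weilClasses_algebraic_hyperbolicSixfold)
    (h10 : Module.finrank ℚ K = 10) (h2 : Module.finrank ℚ k = 2) (i : k →+* K)
    (hB : ∀ m, IsCMTypeRealisation (Φ m) (B m) (ιB m) (θB m))
    (hE : IsCMTypeRealisation Ψ E ιE θE) {τ : k →+* ℂ} (hτΨ : τ ∈ Ψ.1)
    (h23 : ∀ m, (Finset.univ.filter fun s : K →+* ℂ => s.comp i = τ ∧ s ∈ (Φ m).1).card = 2)
    (hInd : ∀ (w : ℤ) (t : Fin r → ℤ), (∀ s : K →+* ℂ, s.comp i = τ → w + ∑ m : Fin r, (if s ∈ (Φ m).1 then t m else 0) = 0) →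
      w = 0 ∧ ∀ m, t m = 0)
    (h2T : ∀ x y : Fin 2 ↪ {s : K →+* ℂ // s.comp i = τ}, ∃ ρ : ℂ ≃+* ℂ, ∀ j : Fin 2, (ρ : ℂ →+* ℂ).comp (x j).1 = (y j).1)
    (κ : Fin N → Fin (r + 1)) {X : AbelianVariety ℂ}
    (hX : AVDominatedBy X (⨁ fun j => (Fin.cons E B : Fin (r + 1) → AbelianVariety ℂ) (κ j))) :
    HodgeConjectureFor X.dim X.X :=
  Domination.hodgeConjectureFor_of_avDominatedBy
    (hodgeConjectureFor_biproduct_comp_cons_of_markman_indep hM6 h10 h2 i hB hE hτΨ h23 hInd h2T κ) hX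

/-! ## §3 The family form -/

variable {n : ℕ} {Θ : Fin n → CMType K} {A : Fin n → AbelianVariety ℂ} {ι : ∀ j, 𝓞 K →+* End (A j)}
  {θ : ∀ j, K →+* Module.End ℂ (complexBetti (A j).X 1)}

/-- **THE FAMILY FORM, TYPES UP TO COMPLEX CONJUGATION.**  `K ⊇ i(k)` ANY CM field of degree `10` over the imaginary quadratic `k`
with `Aut(ℂ)` `2`-transitive on the five embeddings over `τ`; `Φ_1, …, Φ_r` a list of CM types of `K` of `k`-signature `(2,3)`
satisfying the INDEPENDENCE CRITERION `hInd`; `A_j ⊨ (K; Θ_j)` (`j < n`) CM abelian fivefolds each of whose types is one of the `Φ_m`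
OR THE CONJUGATE `Φ̄_m = {s | s̄ ∈ Φ_m}` of one (`k`-signature `(3,2)`; e.g. the complex-conjugate variety of a fivefold of type `Φ_m`);
`E ⊨ (k; Ψ ∋ τ)`.  Then every `C` dominated by `E^a × ∏_j A_j` satisfies the Hodge conjecture, GIVEN ONLY Markman's hyperbolic-sixfold
theorem: `A_j ⊨ (K; Φ̄_m)` realises `Φ_m` through the twisted action `ι ∘ c` (Deligne 1982 §5 (b)), so each `A_j` is isogenous to the
Shimura representative of a listed type. [cite: Markman2025SecantWeil, Thm 1.5.1] [cite: Deligne1982HodgeCycles, §5 (b)]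
[cite: Shimura1998, §6.1 Thm. 2 Cor.] [cite: MumfordAV1970, §19] -/
theorem hodgeConjectureFor_of_avDominatedBy_family_conj_of_markman_indep
    (hM6 : Markman2025_weilClasses_algebraic_hyperbolicSixfold)
    (h10 : Module.finrank ℚ K = 10) (h2 : Module.finrank ℚ k = 2) (i : k →+* K)
    (hA : ∀ j, IsCMTypeRealisation (Θ j) (A j) (ι j) (θ j)) {τ : k →+* ℂ} (Φ : Fin r → CMType K)
    (h23 : ∀ m, (Finset.univ.filter fun s : K →+* ℂ => s.comp i = τ ∧ s ∈ (Φ m).1).card = 2)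
    (hInd : ∀ (w : ℤ) (t : Fin r → ℤ), (∀ s : K →+* ℂ, s.comp i = τ → w + ∑ m : Fin r, (if s ∈ (Φ m).1 then t m else 0) = 0) →
      w = 0 ∧ ∀ m, t m = 0)
    (hpos : ∀ j, ∃ m, Θ j = Φ m ∨ ∀ s : K →+* ℂ, s ∈ (Θ j).1 ↔ ComplexEmbedding.conjugate s ∈ (Φ m).1)
    (h2T : ∀ x y : Fin 2 ↪ {s : K →+* ℂ // s.comp i = τ}, ∃ ρ : ℂ ≃+* ℂ, ∀ l : Fin 2, (ρ : ℂ →+* ℂ).comp (x l).1 = (y l).1)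
    (hE : IsCMTypeRealisation Ψ E ιE θE) (hτΨ : τ ∈ Ψ.1) (a : ℕ)
    {C : AbelianVariety ℂ} (hC : AVDominatedBy C ((⨁ fun _ : Fin a => E).prod (⨁ A))) :
    HodgeConjectureFor C.dim C.X := by
  -- representatives of the listed types (Shimura)
  have hrep : ∀ m : Fin r, ∃ (Bm : AbelianVariety ℂ) (ιm : 𝓞 K →+* End Bm) (θm : K →+* Module.End ℂ (complexBetti Bm.X 1)),
      IsCMTypeRealisation (Φ m) Bm ιm θm := fun m => exists_isCMTypeRealisation (Φ m)
  choose B ιB θB hB using hrep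
  -- each `A_j` is dominated by the representative of its type (twisting the CM structure by `c` in the conjugate case)
  have hdomB : ∀ j, ∃ m : Fin r, AVDominatedBy (A j) (B m) := by
    intro j
    obtain ⟨m, hm | hm⟩ := hpos j
    · exact ⟨m, avDominatedBy_of_cmType_eq hm (hA j) (hB m)⟩
    · have hconj : ∀ φ : K →+* ℂ, φ ∈ (Φ m).1 ↔ ComplexEmbedding.conjugate φ ∈ (Θ j).1 := fun φ => by
        rw [hm (ComplexEmbedding.conjugate φ), ComplexEmbedding.involutive_conjugate K φ]
      exact ⟨m, avDominatedBy_of_cmType_eq rfl ((hA j).comp_complexConj hconj) (hB m)⟩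
  choose m hm using hdomB
  let Y : Fin (r + 1) → AbelianVariety ℂ := Fin.cons E B
  have hYsucc : ∀ m : Fin r, Y m.succ = B m := fun m => by simp only [Y, Fin.cons_succ]
  have hd₁ : AVDominatedBy (⨁ fun _ : Fin a => E) (⨁ fun _ : Fin a => Y 0) :=
    AVDominatedBy.biproduct_map fun _ => AVDominatedBy.refl E
  have hd₂ : AVDominatedBy (⨁ A) (⨁ fun j => Y (m j).succ) :=
    AVDominatedBy.biproduct_map fun j => by rw [hYsucc]; exact hm j
  have h₁₂' := avDominatedBy_prod_of_biproduct hd₁ hd₂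
  let κ' : Fin a ⊕ Fin n → Fin (r + 1) := Sum.elim (fun _ => 0) fun j => (m j).succ
  have hfam : sumFam (fun _ : Fin a => Y 0) (fun j => Y (m j).succ) = Y ∘ κ' := funext fun x => by
    cases x <;> rfl
  rw [hfam] at h₁₂'
  have hdom := avDominatedBy_biproduct_reindex finSumFinEquiv.symm h₁₂'
  exact Domination.hodgeConjectureFor_of_avDominatedBy
    (hodgeConjectureFor_biproduct_comp_cons_of_markman_indep hM6 h10 h2 i hB hE hτΨ h23 hInd h2T (κ' ∘ finSumFinEquiv.symm))
    (hC.trans hdom)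

/-- **THE FAMILY FORM.**  `K ⊇ i(k)` ANY CM field of degree `10` over the imaginary quadratic `k` with `Aut(ℂ)` `2`-transitive on
the five embeddings over `τ`; `Φ_1, …, Φ_r` a list of CM types of `K` of `k`-signature `(2,3)` satisfying the INDEPENDENCE
CRITERION `hInd`; `A_j ⊨ (K; Θ_j)` (`j < n`) CM abelian fivefolds EACH OF WHOSE TYPES IS ONE OF THE `Φ_m` (coincidences allowed —
e.g. Galois conjugates `σB` of one CM fivefold, with any CM structures and polarisations); `E ⊨ (k; Ψ ∋ τ)`.  Then every `C`
dominated by `E^a × ∏_j A_j` satisfies the Hodge conjecture, GIVEN ONLY Markman's hyperbolic-sixfold theorem (representatives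
`B_m ⊨ (K; Φ_m)` by Shimura's existence theorem; each `A_j` is isogenous to the representative of its type). For `r ≤ 3` pairwise
distinct types `hInd` always holds (gens 22–23); for `r = 4` it holds off the `25` four-cycle / triangle-plus-edge configurations;
for `r ≥ 5` never. [cite: Markman2025SecantWeil, Thm 1.5.1] [cite: Shimura1998, §6.1 Thm. 2 Cor.] [cite: MumfordAV1970, §19] -/
theorem hodgeConjectureFor_of_avDominatedBy_family_of_markman_indep
    (hM6 : Markman2025_weilClasses_algebraic_hyperbolicSixfold)
    (h10 : Module.finrank ℚ K = 10) (h2 : Module.finrank ℚ k = 2) (i : k →+* K)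
    (hA : ∀ j, IsCMTypeRealisation (Θ j) (A j) (ι j) (θ j)) {τ : k →+* ℂ} (Φ : Fin r → CMType K)
    (h23 : ∀ m, (Finset.univ.filter fun s : K →+* ℂ => s.comp i = τ ∧ s ∈ (Φ m).1).card = 2)
    (hInd : ∀ (w : ℤ) (t : Fin r → ℤ), (∀ s : K →+* ℂ, s.comp i = τ → w + ∑ m : Fin r, (if s ∈ (Φ m).1 then t m else 0) = 0) →
      w = 0 ∧ ∀ m, t m = 0)
    (hpos : ∀ j, ∃ m, Θ j = Φ m)
    (h2T : ∀ x y : Fin 2 ↪ {s : K →+* ℂ // s.comp i = τ}, ∃ ρ : ℂ ≃+* ℂ, ∀ l : Fin 2, (ρ : ℂ →+* ℂ).comp (x l).1 = (y l).1)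
    (hE : IsCMTypeRealisation Ψ E ιE θE) (hτΨ : τ ∈ Ψ.1) (a : ℕ)
    {C : AbelianVariety ℂ} (hC : AVDominatedBy C ((⨁ fun _ : Fin a => E).prod (⨁ A))) :
    HodgeConjectureFor C.dim C.X :=
  hodgeConjectureFor_of_avDominatedBy_family_conj_of_markman_indep hM6 h10 h2 i hA Φ h23 hInd
    (fun j => (hpos j).imp fun _ hm => Or.inl hm) h2T hE hτΨ a hC

/-- **In particular: the Hodge conjecture for `∏_j A_j` itself** — any finite product of CM abelian fivefolds over `K` whose
`(2,3)`-types are drawn from an independent list — e.g. `B₁ × B₂ × B₃ × B₄` for four types off the four-cycle / triangle-plus-edge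
configurations, the carrier of the six TENFOLD Weil classes of the `B_l × B̄_m` — GIVEN ONLY Markman's sixfold theorem.
[cite: Markman2025SecantWeil, Thm 1.5.1] [cite: MumfordAV1970, §19] -/
theorem hodgeConjectureFor_biproduct_family_of_markman_indep
    (hM6 : Markman2025_weilClasses_algebraic_hyperbolicSixfold)
    (h10 : Module.finrank ℚ K = 10) (h2 : Module.finrank ℚ k = 2) (i : k →+* K)
    (hA : ∀ j, IsCMTypeRealisation (Θ j) (A j) (ι j) (θ j)) {τ : k →+* ℂ} (Φ : Fin r → CMType K)
    (h23 : ∀ m, (Finset.univ.filter fun s : K →+* ℂ => s.comp i = τ ∧ s ∈ (Φ m).1).card = 2)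
    (hInd : ∀ (w : ℤ) (t : Fin r → ℤ), (∀ s : K →+* ℂ, s.comp i = τ → w + ∑ m : Fin r, (if s ∈ (Φ m).1 then t m else 0) = 0) →
      w = 0 ∧ ∀ m, t m = 0)
    (hpos : ∀ j, ∃ m, Θ j = Φ m)
    (h2T : ∀ x y : Fin 2 ↪ {s : K →+* ℂ // s.comp i = τ}, ∃ ρ : ℂ ≃+* ℂ, ∀ l : Fin 2, (ρ : ℂ →+* ℂ).comp (x l).1 = (y l).1)
    (hE : IsCMTypeRealisation Ψ E ιE θE) (hτΨ : τ ∈ Ψ.1) :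
    HodgeConjectureFor (⨁ A).dim (⨁ A).X :=
  hodgeConjectureFor_of_avDominatedBy_family_of_markman_indep hM6 h10 h2 i hA Φ h23 hInd hpos h2T hE hτΨ 0
    (C := ⨁ A) ⟨AbelianVariety.prodLift 0 (𝟙 _), AbelianVariety.snd _ _, 1, one_ne_zero, by
      rw [AbelianVariety.prodLift_snd, one_smul]⟩

end Main

end Summit.HodgeConjecture.CorCM.DecicWeil23Multi

end
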